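import Summits.NavierStokesRegularity.OSWSelfSimilar.SheetNSLineSchochetTwoPole
import Mathlib.Analysis.SpecialFunctions.Sqrt
import HarnessLib

/-!
# The Schochet–ALSS two-pole solution of the viscous CLM on `ℝ`, in time: pole motion and the PDE with the genuine
# Hilbert transform

HONEST FRAMING (cell ns-blowup GROUP B «PROFILE SEARCH», zone Z3, rows Z3-E12⁻ (clause (i′), «the Schochet corner a = 0 is the
divide») and Z3-U addendum A-F2 («ℝ vs 𝕋 at a = 0») of `HOME/profile/z3/CENSUS-Z3.md`; human rulings D-0035/D-0074):
**1-D MODEL (the viscous Constantin–Lax–Majda equation `ω_t = ω·Hω + ν ω_xx` on `ℝ` = gCLM/OSW at `a = 0` with constant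
viscosity, the constant-`ν` reading of the sheet's NS-type line); not Euler, not Navier–Stokes; «violates: none — MODEL».**

CONTENT. The time parametrisation of Schochet's two-pole solution [Schochet 1986, CPAM 39; corrected form
[cite: AmbroseLushnikovSiegelSilantyev2024, §5.1]]: separation `s(t) = √(s₀² + 40kνt)` (`ṡ = 20kν/s`), upper pole depth
`y(t) = (σ − s(t))/2` (`ẏ = −10kν/s`), lower depth `y + s`, amplitude `−24kν/s` (`ȧ = 480k²ν²/s³`), blow-up time
`T = (σ² − s₀²)/(40kν)` (`depth_pos`: `y > 0` for `t < T`). The solution family is carried as function variables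
`s, y, ω, ωx, ωxx` with DEFINING HYPOTHESES (no definitions): `hasDerivAt_solution_x/xx` (slice derivatives),
`hilbertTransform_solution` (genuine `H = hilbertTransform`), **`hasDerivAt_solution_t`: the viscous CLM
`∂ₜ ω = ω·Hω + ν·ωₓₓ` holds at every `x` for every `t` with positive radicand and `y(t) > 0`, given `k² − 6k + 3 = 0`**
(chain rule along the pole motion + `residual_identity` of `SheetNSLineSchochetTwoPole.lean`), `solution_odd`,
`solution_nonpos` (Chen's class 3: `ω ≤ 0` on `(0,∞)`). The blow-up and small-data read-outs and the assembled existence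
theorem are in `SheetNSLineSchochetTwoPoleBlowup.lean`.
WHAT IS NOT HERE: uniqueness of classical solutions; anything about Navier–Stokes. No definitions, no named facts.
bears_on: LADDER-NS N5 / zone Z3 → N1 linear core.
-/

noncomputable section

namespace Summit.NavierStokesRegularity.OSWSelfSimilar
namespace SheetNSLineSchochetTwoPole

open _root_.MeasureTheory Set Filter Literature.Analysis.Fourier
open scoped Real Topology

/-! ### The pole motion: `s(t) = √(s₀² + 40kνt)`, `y(t) = (σ − s(t))/2`, blow-up time `T = (σ² − s₀²)/(40kν)` -/

section Motion

variable {ν k σ s₀ : ℝ} {s y : ℝ → ℝ}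

/-- `s(t) > 0` whenever the radicand is positive (in particular for `t ≥ 0`). [folklore] -/
theorem sep_pos (hs : ∀ t, s t = Real.sqrt (s₀ ^ 2 + 40 * k * ν * t)) {t : ℝ} (ht : 0 < s₀ ^ 2 + 40 * k * ν * t) :
    0 < s t := by
  rw [hs]
  exact Real.sqrt_pos.2 ht

/-- The radicand is positive for `t ≥ 0` (`s₀ > 0`, `k, ν > 0`). [folklore] -/
theorem radicand_pos (hν : 0 < ν) (hk0 : 0 < k) (hs₀ : 0 < s₀) {t : ℝ} (ht : 0 ≤ t) :
    0 < s₀ ^ 2 + 40 * k * ν * t := by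
  positivity

/-- Before the blow-up time the poles have not met the axis: `t < T ⇒ s(t) < σ`, i.e. `y(t) > 0`. [folklore] -/
theorem depth_pos (hν : 0 < ν) (hk0 : 0 < k) (hσ : 0 < σ)
    (hs : ∀ t, s t = Real.sqrt (s₀ ^ 2 + 40 * k * ν * t)) (hy : ∀ t, y t = (σ - s t) / 2) {t : ℝ}
    (ht : t < (σ ^ 2 - s₀ ^ 2) / (40 * k * ν)) : 0 < y t := by
  have h40 : 0 < 40 * k * ν := by positivity
  have hrad : s₀ ^ 2 + 40 * k * ν * t < σ ^ 2 := by
    have := (lt_div_iff₀ h40).1 ht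
    linarith
  have hsσ : s t < σ := by
    rw [hs]
    exact (Real.sqrt_lt' hσ).2 hrad
  rw [hy]
  linarith

/-- `ṡ = 20kν/s`. [folklore] -/
theorem hasDerivAt_sep (hs : ∀ t, s t = Real.sqrt (s₀ ^ 2 + 40 * k * ν * t)) {t : ℝ}
    (ht : 0 < s₀ ^ 2 + 40 * k * ν * t) : HasDerivAt s (20 * k * ν / s t) t := by
  obtain rfl : s = fun t => Real.sqrt (s₀ ^ 2 + 40 * k * ν * t) := funext hs
  have h1 : HasDerivAt (fun t : ℝ => s₀ ^ 2 + 40 * k * ν * t) (40 * k * ν) t := by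
    simpa using ((hasDerivAt_id t).const_mul (40 * k * ν)).const_add (s₀ ^ 2)
  refine (h1.sqrt ht.ne').congr_deriv ?_
  have : Real.sqrt (s₀ ^ 2 + 40 * k * ν * t) ≠ 0 := (Real.sqrt_pos.2 ht).ne'
  field_simp
  ring

/-- `ẏ = −10kν/s` (the upper pole rises toward the axis). [folklore] -/
theorem hasDerivAt_depth (hs : ∀ t, s t = Real.sqrt (s₀ ^ 2 + 40 * k * ν * t))
    (hy : ∀ t, y t = (σ - s t) / 2) {t : ℝ} (ht : 0 < s₀ ^ 2 + 40 * k * ν * t) :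
    HasDerivAt y (-10 * k * ν / s t) t := by
  obtain rfl : y = fun t => (σ - s t) / 2 := funext hy
  refine (((hasDerivAt_sep hs ht).const_sub σ).div_const 2).congr_deriv ?_
  ring

/-- `d/dt (y + s) = +10kν/s` (the lower pole sinks). [folklore] -/
theorem hasDerivAt_depth_add_sep (hs : ∀ t, s t = Real.sqrt (s₀ ^ 2 + 40 * k * ν * t))
    (hy : ∀ t, y t = (σ - s t) / 2) {t : ℝ} (ht : 0 < s₀ ^ 2 + 40 * k * ν * t) :
    HasDerivAt (fun τ => y τ + s τ) (10 * k * ν / s t) t := by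
  refine ((hasDerivAt_depth hs hy ht).add (hasDerivAt_sep hs ht)).congr_deriv ?_
  ring

/-- `ȧ = 480k²ν²/s³` for the amplitude `a = −24kν/s`. [folklore] -/
theorem hasDerivAt_amp (hs : ∀ t, s t = Real.sqrt (s₀ ^ 2 + 40 * k * ν * t)) {t : ℝ}
    (ht : 0 < s₀ ^ 2 + 40 * k * ν * t) :
    HasDerivAt (fun τ => -24 * k * ν / s τ) (480 * k ^ 2 * ν ^ 2 / s t ^ 3) t := by
  have hst : s t ≠ 0 := (sep_pos hs ht).ne'
  refine ((hasDerivAt_const t (-24 * k * ν)).div (hasDerivAt_sep hs ht) hst).congr_deriv ?_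
  field_simp
  ring

end Motion

/-! ### The solution: x-derivatives, the PDE, sign class, blow-up read-outs -/

section Solution

variable {ν k σ s₀ : ℝ} {s y : ℝ → ℝ} {ω ωx ωxx : ℝ → ℝ → ℝ}

/-- `∂ₓ ω = ωₓ` on the solution family (pole depths `y(t)`, `y(t) + s(t)` positive). [folklore] -/
theorem hasDerivAt_solution_x
    (hω : ∀ t x, ω t x = (-24 * k * ν / s t) * (x / (x ^ 2 + y t ^ 2) - x / (x ^ 2 + (y t + s t) ^ 2))
      + (-12 * ν) * (2 * y t * x / (x ^ 2 + y t ^ 2) ^ 2 + 2 * (y t + s t) * x / (x ^ 2 + (y t + s t) ^ 2) ^ 2))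
    (hωx : ∀ t x, ωx t x = (-24 * k * ν / s t) * ((y t ^ 2 - x ^ 2) / (x ^ 2 + y t ^ 2) ^ 2
        - ((y t + s t) ^ 2 - x ^ 2) / (x ^ 2 + (y t + s t) ^ 2) ^ 2)
      + (-12 * ν) * (2 * y t * (y t ^ 2 - 3 * x ^ 2) / (x ^ 2 + y t ^ 2) ^ 3
        + 2 * (y t + s t) * ((y t + s t) ^ 2 - 3 * x ^ 2) / (x ^ 2 + (y t + s t) ^ 2) ^ 3))
    {t : ℝ} (hyt : 0 < y t) (hst : 0 < s t) (x : ℝ) : HasDerivAt (ω t) (ωx t x) x := by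
  have e : ω t = fun x => (-24 * k * ν / s t) * (x / (x ^ 2 + y t ^ 2) - x / (x ^ 2 + (y t + s t) ^ 2))
      + (-12 * ν) * (2 * y t * x / (x ^ 2 + y t ^ 2) ^ 2 + 2 * (y t + s t) * x / (x ^ 2 + (y t + s t) ^ 2) ^ 2) :=
    funext (hω t)
  rw [e, hωx]
  exact hasDerivAt_twoPole_x hyt (by linarith) _ _ x

/-- `∂ₓ ωₓ = ωₓₓ` on the solution family. [folklore] -/
theorem hasDerivAt_solution_xx
    (hωx : ∀ t x, ωx t x = (-24 * k * ν / s t) * ((y t ^ 2 - x ^ 2) / (x ^ 2 + y t ^ 2) ^ 2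
        - ((y t + s t) ^ 2 - x ^ 2) / (x ^ 2 + (y t + s t) ^ 2) ^ 2)
      + (-12 * ν) * (2 * y t * (y t ^ 2 - 3 * x ^ 2) / (x ^ 2 + y t ^ 2) ^ 3
        + 2 * (y t + s t) * ((y t + s t) ^ 2 - 3 * x ^ 2) / (x ^ 2 + (y t + s t) ^ 2) ^ 3))
    (hωxx : ∀ t x, ωxx t x = (-24 * k * ν / s t) * (2 * x * (x ^ 2 - 3 * y t ^ 2) / (x ^ 2 + y t ^ 2) ^ 3
        - 2 * x * (x ^ 2 - 3 * (y t + s t) ^ 2) / (x ^ 2 + (y t + s t) ^ 2) ^ 3)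
      + (-12 * ν) * (24 * y t * x * (x ^ 2 - y t ^ 2) / (x ^ 2 + y t ^ 2) ^ 4
        + 24 * (y t + s t) * x * (x ^ 2 - (y t + s t) ^ 2) / (x ^ 2 + (y t + s t) ^ 2) ^ 4))
    {t : ℝ} (hyt : 0 < y t) (hst : 0 < s t) (x : ℝ) : HasDerivAt (ωx t) (ωxx t x) x := by
  have e : ωx t = fun x => (-24 * k * ν / s t) * ((y t ^ 2 - x ^ 2) / (x ^ 2 + y t ^ 2) ^ 2
        - ((y t + s t) ^ 2 - x ^ 2) / (x ^ 2 + (y t + s t) ^ 2) ^ 2)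
      + (-12 * ν) * (2 * y t * (y t ^ 2 - 3 * x ^ 2) / (x ^ 2 + y t ^ 2) ^ 3
        + 2 * (y t + s t) * ((y t + s t) ^ 2 - 3 * x ^ 2) / (x ^ 2 + (y t + s t) ^ 2) ^ 3) :=
    funext (hωx t)
  rw [e, hωxx]
  exact hasDerivAt_twoPole_xx hyt (by linarith) _ _ x

/-- **The Hilbert transform of the solution slice** (genuine `hilbertTransform`). [folklore] -/
theorem hilbertTransform_solution
    (hω : ∀ t x, ω t x = (-24 * k * ν / s t) * (x / (x ^ 2 + y t ^ 2) - x / (x ^ 2 + (y t + s t) ^ 2))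
      + (-12 * ν) * (2 * y t * x / (x ^ 2 + y t ^ 2) ^ 2 + 2 * (y t + s t) * x / (x ^ 2 + (y t + s t) ^ 2) ^ 2))
    {t : ℝ} (hyt : 0 < y t) (hst : 0 < s t) (x : ℝ) :
    hilbertTransform (ω t) x = -((-24 * k * ν / s t) * (y t / (x ^ 2 + y t ^ 2) - (y t + s t) / (x ^ 2 + (y t + s t) ^ 2)))
      - (-12 * ν) * ((y t ^ 2 - x ^ 2) / (x ^ 2 + y t ^ 2) ^ 2 + ((y t + s t) ^ 2 - x ^ 2) / (x ^ 2 + (y t + s t) ^ 2) ^ 2) := by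
  have e : ω t = fun x => (-24 * k * ν / s t) * (x / (x ^ 2 + y t ^ 2) - x / (x ^ 2 + (y t + s t) ^ 2))
      + (-12 * ν) * (2 * y t * x / (x ^ 2 + y t ^ 2) ^ 2 + 2 * (y t + s t) * x / (x ^ 2 + (y t + s t) ^ 2) ^ 2) :=
    funext (hω t)
  rw [e]
  exact hilbertTransform_twoPole hyt (by linarith) _ _ x

/-- **THE PDE.** On the solution family the viscous CLM `∂ₜω = ω·Hω + ν·ωₓₓ` holds pointwise, with the GENUINE Hilbert
transform, at every `x` and every `t` with positive radicand before the blow-up time (in particular on `0 ≤ t < T`), provided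
`k² − 6k + 3 = 0`. Chain rule along the pole motion + `residual_identity`.
[cite: AmbroseLushnikovSiegelSilantyev2024, §5.1 (Schochet's pole-dynamics solution, corrected constants)] -/
theorem hasDerivAt_solution_t (hk : k ^ 2 - 6 * k + 3 = 0)
    (hs : ∀ t, s t = Real.sqrt (s₀ ^ 2 + 40 * k * ν * t)) (hy : ∀ t, y t = (σ - s t) / 2)
    (hω : ∀ t x, ω t x = (-24 * k * ν / s t) * (x / (x ^ 2 + y t ^ 2) - x / (x ^ 2 + (y t + s t) ^ 2))
      + (-12 * ν) * (2 * y t * x / (x ^ 2 + y t ^ 2) ^ 2 + 2 * (y t + s t) * x / (x ^ 2 + (y t + s t) ^ 2) ^ 2))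
    (hωxx : ∀ t x, ωxx t x = (-24 * k * ν / s t) * (2 * x * (x ^ 2 - 3 * y t ^ 2) / (x ^ 2 + y t ^ 2) ^ 3
        - 2 * x * (x ^ 2 - 3 * (y t + s t) ^ 2) / (x ^ 2 + (y t + s t) ^ 2) ^ 3)
      + (-12 * ν) * (24 * y t * x * (x ^ 2 - y t ^ 2) / (x ^ 2 + y t ^ 2) ^ 4
        + 24 * (y t + s t) * x * (x ^ 2 - (y t + s t) ^ 2) / (x ^ 2 + (y t + s t) ^ 2) ^ 4))
    {t : ℝ} (hrad : 0 < s₀ ^ 2 + 40 * k * ν * t) (hyt : 0 < y t) (x : ℝ) :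
    HasDerivAt (fun τ => ω τ x) (ω t x * hilbertTransform (ω t) x + ν * ωxx t x) t := by
  have hst : 0 < s t := sep_pos hs hrad
  have hy2 : 0 < y t + s t := by linarith
  -- the chain-rule derivative
  have hA := hasDerivAt_amp hs hrad
  have hY := hasDerivAt_depth hs hy hrad
  have hY2 := hasDerivAt_depth_add_sep hs hy hrad
  have hF := ((hasDerivAt_f_depth hyt x).comp t hY).sub ((hasDerivAt_f_depth hy2 x).comp t hY2)
  have hG := ((hasDerivAt_g_depth hyt x).comp t hY).add ((hasDerivAt_g_depth hy2 x).comp t hY2)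
  have hD := (hA.mul hF).add (hG.const_mul (-12 * ν))
  have e : (fun τ => ω τ x) = fun τ => (-24 * k * ν / s τ) * (x / (x ^ 2 + y τ ^ 2) - x / (x ^ 2 + (y τ + s τ) ^ 2))
      + (-12 * ν) * (2 * y τ * x / (x ^ 2 + y τ ^ 2) ^ 2 + 2 * (y τ + s τ) * x / (x ^ 2 + (y τ + s τ) ^ 2) ^ 2) :=
    funext fun τ => hω τ x
  rw [e]
  refine (hD.congr_of_eventuallyEq (Eventually.of_forall fun τ => ?_)).congr_deriv ?_
  · simp only [Pi.add_apply, Pi.mul_apply, Pi.sub_apply, Function.comp]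
  rw [hilbertTransform_solution hω hyt hst x, hω t x, hωxx t x]
  have hsne : s t ≠ 0 := hst.ne'
  have hyne : x ^ 2 + y t ^ 2 ≠ 0 := by positivity
  have hysne : x ^ 2 + (y t + s t) ^ 2 ≠ 0 := by positivity
  have E := residual_identity ν k (s t) (y t) x hsne hyne hysne
  simp only [Pi.sub_apply, Function.comp_apply]
  linear_combination E + (-96 * ν ^ 2 * x * (s t + 2 * y t) * (x ^ 2 - y t ^ 2 - s t * y t)
      / ((x ^ 2 + y t ^ 2) ^ 2 * (x ^ 2 + (y t + s t) ^ 2) ^ 2)) * hk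

/-- Oddness of every slice. [folklore] -/
theorem solution_odd
    (hω : ∀ t x, ω t x = (-24 * k * ν / s t) * (x / (x ^ 2 + y t ^ 2) - x / (x ^ 2 + (y t + s t) ^ 2))
      + (-12 * ν) * (2 * y t * x / (x ^ 2 + y t ^ 2) ^ 2 + 2 * (y t + s t) * x / (x ^ 2 + (y t + s t) ^ 2) ^ 2))
    (t x : ℝ) : ω t (-x) = -ω t x := by
  rw [hω, hω]
  ring

/-- Sign class 3 of Chen: `ω(t,x) ≤ 0` for `x > 0` (amplitude `−24kν/s < 0`, depths `0 < y < y + s`).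
[cite: AmbroseLushnikovSiegelSilantyev2024, §5.1.1 (odd configuration on the negative imaginary axis)] -/
theorem solution_nonpos (hν : 0 < ν) (hk0 : 0 < k)
    (hω : ∀ t x, ω t x = (-24 * k * ν / s t) * (x / (x ^ 2 + y t ^ 2) - x / (x ^ 2 + (y t + s t) ^ 2))
      + (-12 * ν) * (2 * y t * x / (x ^ 2 + y t ^ 2) ^ 2 + 2 * (y t + s t) * x / (x ^ 2 + (y t + s t) ^ 2) ^ 2))
    {t : ℝ} (hyt : 0 < y t) (hst : 0 < s t) {x : ℝ} (hx : 0 < x) : ω t x ≤ 0 := by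
  rw [hω]
  have hy2 : 0 < y t + s t := by linarith
  have ha : -24 * k * ν / s t < 0 := div_neg_of_neg_of_pos (by nlinarith [mul_pos hk0 hν]) hst
  have h1 : x / (x ^ 2 + (y t + s t) ^ 2) ≤ x / (x ^ 2 + y t ^ 2) := by
    apply div_le_div_of_nonneg_left hx.le (by positivity)
    nlinarith
  have h2 : 0 ≤ 2 * y t * x / (x ^ 2 + y t ^ 2) ^ 2 + 2 * (y t + s t) * x / (x ^ 2 + (y t + s t) ^ 2) ^ 2 := by
    positivity
  nlinarith [mul_nonpos_of_nonpos_of_nonneg ha.le (sub_nonneg.2 h1)]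

end Solution

end SheetNSLineSchochetTwoPole
end Summit.NavierStokesRegularity.OSWSelfSimilar

end
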